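import Summits.PneNP.PneNP.Theorems.ExpanderLinearGeneratorsExpandingCNF
import Summits.PneNP.PneNP.Theorems.ExpanderLinearGeneratorsRandomKCNFPrep
import Literature.Computability.MetaComplexity.SumOfSquaresProofs
import Literature.Computability.MetaComplexity.RandomCNFResolutionProofs
import Mathlib.Topology.Instances.ENNReal.Lemmas

/-!
# PneNP / ExpanderLinearGenerators — the crux implies that random `k`-CNFs are exponentially hard
for bounded-depth `textbookFrege` (`k ≥ 10`, density `≥ 2^k`)

Route `PneNP/ExpanderLinearGenerators`, crux stmt-PneNP-11443
(`Summit.PneNP.PneNP.Theses.ExpanderLinearGenerators.LinearGeneratorDepthFregeHard`). The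
calibration `LinGen.expandingCNF_depthFregeHard_of_linearGeneratorDepthFregeHard` (the crux gives
exponential depth-`d` Frege lower bounds for every unsatisfiable `ℓ`-CNF with
`(n^{1-δ}, 3ℓ/4)`-boundary-expanding clause supports) is made concrete on the tree's random
`k`-CNF model `randomKCNF k n m` (`m` i.i.d. uniform clauses on `k` distinct variables): for
`k ≥ 10` and a natural density `Δ ≥ 2^k`,

  crux ⇒ `∃ ε > 0, Pr_{φ ∼ F_k(n, Δ n)}[every depth-d textbookFrege proof of ¬φ has size ≥ 2^{n^ε}] → 1`.

Super-polynomial bounded-depth Frege lower bounds for random `k`-CNFs of linear size are a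
long-standing open problem (Gryaznov–Talebanfard 2024: `Ω(n^{1+ε_d})` steps is the state of the
art; cf. the Feige route's crux `FeigeRandom3cnfHardForDepthDFrege`, stmt-PneNP-0298, for `k = 3`
and all Frege systems). Ingredients, all first-moment counts in the i.i.d. model:
unsatisfiability w.h.p. for `Δ ≥ 2^k` (`card_le_of_forall_satisfiable`), and `(γ n, 7k/8)`-COVER
expansion w.h.p. (a fixed-radius first moment, `card_le_of_forall_not_isCoverExpander_gen` of the companion
file `…RandomKCNFPrep`, the tree's
Chvátal–Szemerédi / Ben-Sasson–Wigderson computation run at cover ratio `a = 7k/8`, which needs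
`a + 5/4 ≤ k`, i.e. `k ≥ 10`), whence `(γ n, 3k/4)`-BOUNDARY expansion
(`IsCoverExpander.isBoundaryExpander`).

* `fst_lt_of_mem_kClauses` — the variables of a member of `kClauses k n` are `< n` (length `k`
  and distinct variables: `length_of_mem_kClauses`, `nodup_map_fst_of_mem_kClauses` of the
  Literature);
* `tendsto_unsat_fraction` — `2^n (1 - 2^{-k})^{Δ n} → 0` for `Δ ≥ 2^k`;
* `randomKCNF_hard_of_linearGeneratorDepthFregeHard` — the statement displayed above;
* `randomKCNF_noShortProofs_of_linearGeneratorDepthFregeHard` — the same in the shape of the Feige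
  route's crux `FeigeRandom3cnfHardForDepthDFrege` (probability of a proof of size `≤ p(n)` → 0).

References: V. Chvátal, E. Szemerédi, J. ACM 35 (1988), Lemma 1 and §1; E. Ben-Sasson,
A. Wigderson, J. ACM 48 (2001), §6; S. Gryaznov, N. Talebanfard, arXiv:2403.02275 (2024);
J. Krajíček, *Proof complexity* (CUP 2019), Problem 19.4.5.
-/

namespace Summit.PneNP.PneNP.Theorems.LinGen

open Filter Topology MeasureTheory Finset Real
open Literature.Computability.Complexity Literature.Computability.MetaComplexity

/-! ### Members of `kClauses` -/

/-- The variables of a `k`-clause over `n` variables are `< n`. [folklore] -/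
theorem fst_lt_of_mem_kClauses {k n : ℕ} {x : Clause ℕ} (hx : x ∈ kClauses k n) :
    ∀ l ∈ x, l.1 < n := by
  intro l hl
  have h1 : l.1 ∈ clauseScope x := by
    rw [clauseScope, List.mem_toFinset]
    exact List.mem_map.2 ⟨l, hl, rfl⟩
  exact Finset.mem_range.1 (clauseScope_subset_range hx h1)

/-! ### The failure probability tends to zero -/

/-- `2^n (1 - 2^{-k})^{Δ n} → 0` for `Δ ≥ 2^k` (indeed `(1 - 2^{-k})^{2^k} ≤ e^{-1} < 1/2`).
[Chvátal–Szemerédi 1988, §1; Franco–Paull 1983] [folklore] -/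
theorem tendsto_unsat_fraction {k Δ : ℕ} (hΔ : 2 ^ k ≤ Δ) :
    Tendsto (fun n : ℕ => (2 : ℝ) ^ n * (1 - (1 / 2 : ℝ) ^ k) ^ (Δ * n)) atTop (𝓝 0) := by
  set q : ℝ := 1 - (1 / 2 : ℝ) ^ k with hq
  have hq0 : 0 ≤ q := by
    rw [hq, sub_nonneg]
    exact pow_le_one₀ (by norm_num) (by norm_num)
  have hq1 : q ≤ 1 := by
    rw [hq, sub_le_self_iff]
    positivity
  have hqk : q ^ (2 ^ k) ≤ Real.exp (-1) := by
    have h1 : q = 1 - 1 / ((2 ^ k : ℕ) : ℝ) := by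
      rw [hq]; push_cast; rw [one_div_pow]
    rw [h1]
    exact Real.one_sub_div_pow_le_exp_neg (by exact_mod_cast Nat.one_le_two_pow)
  have hqΔ : q ^ Δ ≤ Real.exp (-1) := (pow_le_pow_of_le_one hq0 hq1 hΔ).trans hqk
  have he : Real.exp (-1) < 1 / 2 := by
    rw [Real.exp_neg, inv_lt_comm₀ (Real.exp_pos 1) (by norm_num)]
    have := Real.exp_one_gt_d9
    norm_num at this ⊢
    linarith
  have hbase0 : 0 ≤ 2 * q ^ Δ := by positivity
  have hbase1 : 2 * q ^ Δ < 1 := by linarith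
  have ht := tendsto_pow_atTop_nhds_zero_of_lt_one hbase0 hbase1
  refine ht.congr fun n => ?_
  rw [mul_pow, pow_mul]

/-! ### The theorem -/

/-- **The crux implies that random `k`-CNFs are exponentially hard for bounded-depth
`textbookFrege`.** Assume `LinearGeneratorDepthFregeHard`. Then for every `k ≥ 10`, every natural
density `Δ ≥ 2^k` and every depth `d` there is `ε > 0` with
`Pr_{φ ∼ F_k(n, Δ n)}[every depth-d textbookFrege proof of ¬φ has size ≥ 2^{n^ε}] → 1`
(`F_k(n,m) = randomKCNF k n m`, i.i.d. uniform `k`-clauses on distinct variables). Proof: with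
probability `≥ 1 - O(1/n) - 2^n (1-2^{-k})^{Δ n}` the formula is unsatisfiable and its clause
supports form a `(γ n, 7k/8)`-cover, hence `(γ n, 3k/4)`-boundary, expander (first moments); on
that event `expandingCNF_depthFregeHard_of_linearGeneratorDepthFregeHard` (at `ℓ = k`, `δ = 1/2`)
applies for large `n`. The conclusion — super-polynomial `AC⁰`-Frege lower bounds for random
`k`-CNFs of linear size — is open in print (Gryaznov–Talebanfard 2024). [Krajíček 2019, Problem
19.4.5; Chvátal–Szemerédi 1988; Ben-Sasson–Wigderson 2001, §6; Gryaznov–Talebanfard 2024] -/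
theorem randomKCNF_hard_of_linearGeneratorDepthFregeHard
    (hX : Summit.PneNP.PneNP.Theses.ExpanderLinearGenerators.LinearGeneratorDepthFregeHard)
    (k Δ d : ℕ) (hk : 10 ≤ k) (hΔ : 2 ^ k ≤ Δ) :
    ∃ ε : ℝ, 0 < ε ∧ Tendsto (fun n : ℕ => (randomKCNF k n (Δ * n)).toOuterMeasure
      {φ | ∀ pf : List (PropForm ℕ),
        textbookFrege.IsDepthProofOf d pf (PropForm.neg (PropForm.ofCNF φ)) →
          (2 : ℝ) ^ ((n : ℝ) ^ ε) ≤ (proofSize pf : ℝ)}) atTop (𝓝 1) := by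
  obtain ⟨ε, hε, N₁, hN₁⟩ := expandingCNF_depthFregeHard_of_linearGeneratorDepthFregeHard hX k d
    (1 / 2) (by omega) (by norm_num) (by norm_num)
  refine ⟨ε, hε, ?_⟩
  -- constants
  have hk' : (10 : ℝ) ≤ k := by exact_mod_cast hk
  have hΔ1 : 1 ≤ Δ := le_trans Nat.one_le_two_pow hΔ
  set a : ℝ := 7 * k / 8 with ha
  set B : ℝ := Real.exp (1 + a) * Δ * a with hB
  have ha74 : 7 / 4 ≤ a := by rw [ha]; linarith
  have hak : a + 5 / 4 ≤ k := by rw [ha]; linarith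
  have hapos : 0 < a := by linarith
  have hBpos : 0 < B := by rw [hB]; positivity
  set c₀ : ℝ := a * (2 * B) ^ 4 with hc₀
  have hc₀pos : 0 < c₀ := by positivity
  set β : ℕ → ℝ := fun n => 32 * a * B ^ 4 / n + (2 : ℝ) ^ n * (1 - (1 / 2 : ℝ) ^ k) ^ (Δ * n)
    with hβ
  have hβ0 : ∀ n, 0 ≤ β n := fun n => by
    simp only [hβ]
    have : 0 ≤ 1 - (1 / 2 : ℝ) ^ k := sub_nonneg.2 (pow_le_one₀ (by norm_num) (by norm_num))
    positivity
  -- `β → 0`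
  have hβlim : Tendsto β atTop (𝓝 0) := by
    have h1 : Tendsto (fun n : ℕ => 32 * a * B ^ 4 / (n : ℝ)) atTop (𝓝 0) :=
      tendsto_const_div_atTop_nhds_zero_nat _
    have h2 := tendsto_unsat_fraction (k := k) hΔ
    simpa [hβ] using h1.add h2
  -- the radius eventually exceeds `n^{1/2}`
  have hrad : ∀ᶠ n : ℕ in atTop, (n : ℝ) ^ (1 - 1 / 2 : ℝ) ≤ ⌊(n : ℝ) / c₀⌋₊ := by
    have hT : Tendsto (fun n : ℕ => (n : ℝ) ^ (1 - 1 / 2 : ℝ)) atTop atTop :=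
      (tendsto_rpow_atTop (by norm_num)).comp tendsto_natCast_atTop_atTop
    filter_upwards [hT.eventually_ge_atTop (max (2 * c₀) 1)] with n hn
    set s : ℝ := (n : ℝ) ^ (1 - 1 / 2 : ℝ) with hs
    have hn0 : (0 : ℝ) ≤ n := Nat.cast_nonneg n
    have hss : s * s = n := by
      rw [hs, ← Real.rpow_add' hn0 (by norm_num)]
      norm_num
    have hs1 : 1 ≤ s := le_trans (le_max_right _ _) hn
    have hs2 : 2 * c₀ ≤ s := le_trans (le_max_left _ _) hn
    have h1 : 2 * c₀ * s ≤ n := by rw [← hss]; exact mul_le_mul_of_nonneg_right hs2 (by linarith)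
    have h2 : 2 * s ≤ n / c₀ := by
      rw [le_div_iff₀ hc₀pos]; linarith
    have h3 : (n : ℝ) / c₀ - 1 < ⌊(n : ℝ) / c₀⌋₊ := by
      have := Nat.lt_floor_add_one ((n : ℝ) / c₀); linarith
    linarith
  -- the measure bound, eventually
  have hev : ∀ᶠ n : ℕ in atTop, 1 - ENNReal.ofReal (β n) ≤ (randomKCNF k n (Δ * n)).toOuterMeasure
      {φ | ∀ pf : List (PropForm ℕ),
        textbookFrege.IsDepthProofOf d pf (PropForm.neg (PropForm.ofCNF φ)) →
          (2 : ℝ) ^ ((n : ℝ) ^ ε) ≤ (proofSize pf : ℝ)} := by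
    filter_upwards [hrad, eventually_ge_atTop (max N₁ k)] with n hradn hn
    have hnN : N₁ ≤ n := le_trans (le_max_left _ _) hn
    have hnk : k ≤ n := le_trans (le_max_right _ _) hn
    have hn1 : 1 ≤ n := le_trans (by omega) hnk
    have hn' : (0 : ℝ) < n := by exact_mod_cast hn1
    classical
    have hKc : (kClauses k n).card = n.choose k * 2 ^ k := card_kClauses k n
    have hKne : (kClauses k n).Nonempty := by
      rw [← Finset.card_pos, hKc]
      exact Nat.mul_pos (Nat.choose_pos hnk) (pow_pos two_pos _)
    set N : ℕ := ⌊(n : ℝ) / c₀⌋₊ with hNdef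
    have hN : a * N ≤ n / (2 * B) ^ 4 := by
      have h1 : (N : ℝ) ≤ n / c₀ := Nat.floor_le (by positivity)
      calc a * N ≤ a * (n / c₀) := mul_le_mul_of_nonneg_left h1 hapos.le
        _ = n / (2 * B) ^ 4 := by rw [hc₀]; field_simp
    -- the bad tuples
    set m : ℕ := Δ * n with hm
    set bad₁ : Finset (Fin m → ↥(kClauses k n)) :=
      univ.filter fun c => CNF.Satisfiable (List.ofFn fun i => (c i : Clause ℕ)) with hbad₁
    set bad₂ : Finset (Fin m → ↥(kClauses k n)) :=
      univ.filter fun c => ¬ IsCoverExpander (fun i => clauseScope (c i : Clause ℕ)) N a with hbad₂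
    have hcard₁ : bad₁.card ≤ 2 ^ n * (n.choose k * (2 ^ k - 1)) ^ m :=
      card_le_of_forall_satisfiable bad₁ fun c hc => (mem_filter.1 hc).2
    have hcard₂ : (bad₂.card : ℝ) ≤ 32 * a * B ^ 4 / n * ((((kClauses k n).card ^ m : ℕ)) : ℝ) :=
      card_le_of_forall_not_isCoverExpander_gen hΔ1 hn1 hKne ha74 hak hB hN bad₂
        fun c hc => (mem_filter.1 hc).2
    have hcard : ((bad₁ ∪ bad₂).card : ℝ) ≤ β n * ((((kClauses k n).card ^ m : ℕ)) : ℝ) := by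
      have h1 : ((bad₁ ∪ bad₂).card : ℝ) ≤ bad₁.card + bad₂.card := by
        exact_mod_cast Finset.card_union_le _ _
      have h2 : (bad₁.card : ℝ) ≤ ((2 ^ n * (n.choose k * (2 ^ k - 1)) ^ m : ℕ) : ℝ) := by
        exact_mod_cast hcard₁
      have h3 : ((2 ^ n * (n.choose k * (2 ^ k - 1)) ^ m : ℕ) : ℝ) =
          (2 : ℝ) ^ n * (1 - (1 / 2 : ℝ) ^ k) ^ m * ((((kClauses k n).card ^ m : ℕ)) : ℝ) := by
        rw [hKc]
        have h2k : (1 : ℝ) ≤ 2 ^ k := one_le_pow₀ (by norm_num)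
        push_cast [Nat.one_le_two_pow]
        rw [mul_assoc, ← mul_pow]
        congr 2
        rw [one_div_pow]
        field_simp
      rw [h3] at h2
      simp only [hβ]
      nlinarith [hcard₂, h2, h1]
    -- the glue
    refine randomKCNF_toOuterMeasure_ge hKne (hβ0 n) (bad₁ ∪ bad₂) (fun c hc => ?_) hcard
    rw [Finset.mem_union, not_or] at hc
    obtain ⟨hc1, hc2⟩ := hc
    have hunsat : ¬ CNF.Satisfiable (List.ofFn fun i => (c i : Clause ℕ)) := fun h =>
      hc1 (mem_filter.2 ⟨mem_univ _, h⟩)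
    have hcov : IsCoverExpander (fun i => clauseScope (c i : Clause ℕ)) N a := by
      by_contra h
      exact hc2 (mem_filter.2 ⟨mem_univ _, h⟩)
    have hbdry : IsBoundaryExpander (fun i => clauseScope (c i : Clause ℕ)) N (3 / 4 * k) := by
      refine IsCoverExpander.isBoundaryExpander (k := k)
        (fun i => (card_clauseScope_of_mem_kClauses (c i).2).le) ?_
      have : ((k : ℝ) + 3 / 4 * k) / 2 = a := by rw [ha]; ring
      rw [this]
      exact hcov
    have hexp : IsBoundaryExpander (fun i => (((c i : Clause ℕ)).map Prod.fst).toFinset)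
        ((n : ℝ) ^ (1 - 1 / 2 : ℝ)) (3 / 4 * k) :=
      hbdry.mono hradn
    intro pf hpf
    exact hN₁ n hnN m (fun i => (c i : Clause ℕ)) (fun i => nodup_map_fst_of_mem_kClauses (c i).2)
      (fun i => fst_lt_of_mem_kClauses (c i).2) (fun i => (length_of_mem_kClauses (c i).2).le)
      hexp hunsat pf hpf
  -- squeeze
  have hlow : Tendsto (fun n : ℕ => 1 - ENNReal.ofReal (β n)) atTop (𝓝 1) := by
    have h1 : Tendsto (fun n : ℕ => ENNReal.ofReal (β n)) atTop (𝓝 0) := by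
      rw [← ENNReal.ofReal_zero]
      exact ENNReal.tendsto_ofReal hβlim
    have h2 := ENNReal.Tendsto.sub (tendsto_const_nhds (x := (1 : ENNReal))) h1
      (Or.inl ENNReal.one_ne_top)
    simpa using h2
  exact tendsto_of_tendsto_of_tendsto_of_le_of_le' hlow tendsto_const_nhds hev
    (Eventually.of_forall fun n => (measure_mono (Set.subset_univ _)).trans
      ((PMF.toOuterMeasure_apply_eq_one_iff _ _).2 (Set.subset_univ _)).le)

/-- **The crux implies the `k`-CNF form of Feige's bounded-depth crux for `textbookFrege`.**
Assume `LinearGeneratorDepthFregeHard`. Then for `k ≥ 10`, a natural density `Δ ≥ 2^k`, every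
depth `d` and every polynomial `p`,
`Pr_{φ ∼ F_k(n, Δ n)}[∃ depth-d textbookFrege proof of ¬φ of size ≤ p(n)] → 0` — the shape of the
Feige route's crux `FeigeRandom3cnfHardForDepthDFrege` (stmt-PneNP-0298: `k = 3`, real density
`> 5.2`, every Frege system), here for `k ≥ 10` and the textbook system. From
`randomKCNF_hard_of_linearGeneratorDepthFregeHard`: eventually `p(n) < 2^{n^ε}`, so the event is
inside the complement of the high-probability event, whose mass is `1 - (→ 1) → 0`.
[Krajíček 2019, Problem 19.4.5; Gryaznov–Talebanfard 2024 (status for random CNFs)] -/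
theorem randomKCNF_noShortProofs_of_linearGeneratorDepthFregeHard
    (hX : Summit.PneNP.PneNP.Theses.ExpanderLinearGenerators.LinearGeneratorDepthFregeHard)
    (k Δ d : ℕ) (hk : 10 ≤ k) (hΔ : 2 ^ k ≤ Δ) (p : Polynomial ℕ) :
    Tendsto (fun n : ℕ => (randomKCNF k n (Δ * n)).toOuterMeasure
      {φ | ∃ pf : List (PropForm ℕ),
        textbookFrege.IsDepthProofOf d pf (PropForm.neg (PropForm.ofCNF φ)) ∧
          proofSize pf ≤ p.eval n}) atTop (𝓝 0) := by
  obtain ⟨ε, hε, hT⟩ := randomKCNF_hard_of_linearGeneratorDepthFregeHard hX k Δ d hk hΔ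
  -- eventually `p(n) < 2^{n^ε}`
  obtain ⟨c, e, hce⟩ := exists_eval_le_mul_pow_add p
  have hev : ∀ᶠ n : ℕ in atTop, ((p.eval n : ℕ) : ℝ) < (2 : ℝ) ^ ((n : ℝ) ^ ε) := by
    have h1 := eventually_pow_lt_two_rpow_rpow (e + 1) hε
    filter_upwards [h1, eventually_ge_atTop (2 * c + 1)] with n hn hnc
    have hn1 : (2 * c + 1 : ℝ) ≤ n := by exact_mod_cast hnc
    have hc0 : (0 : ℝ) ≤ c := Nat.cast_nonneg c
    have hne : (1 : ℝ) ≤ (n : ℝ) ^ e := one_le_pow₀ (by linarith)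
    have h2 : ((p.eval n : ℕ) : ℝ) ≤ c * (n : ℝ) ^ e + c := by exact_mod_cast hce n
    have h3 : (c : ℝ) * (n : ℝ) ^ e + c ≤ (n : ℝ) ^ (e + 1) := by
      rw [pow_succ]
      nlinarith
    have h5 : ((n : ℝ) ^ (e + 1) : ℝ) < (2 : ℝ) ^ ((n : ℝ) ^ ε) := by simpa using hn
    linarith
  -- complements under the outer measure of a `PMF`
  have hcompl : ∀ (q : PMF (CNF ℕ)) (s : Set (CNF ℕ)),
      q.toOuterMeasure sᶜ = 1 - q.toOuterMeasure s := by
    intro q s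
    have hadd : q.toOuterMeasure s + q.toOuterMeasure sᶜ = 1 := by
      rw [PMF.toOuterMeasure_apply, PMF.toOuterMeasure_apply, ← ENNReal.tsum_add, ← q.tsum_coe]
      refine tsum_congr fun x => ?_
      by_cases hx : x ∈ s
      · rw [Set.indicator_of_mem hx, Set.indicator_of_notMem (show x ∉ sᶜ from fun h => h hx),
          add_zero]
      · rw [Set.indicator_of_notMem hx, Set.indicator_of_mem (show x ∈ sᶜ from hx), zero_add]
    have hle : q.toOuterMeasure s ≤ 1 := le_of_le_of_eq le_self_add hadd
    rw [add_comm] at hadd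
    exact ENNReal.eq_sub_of_add_eq (hle.trans_lt ENNReal.one_lt_top).ne hadd
  -- the small-proof event sits in the complement of the high-probability event
  have hle : ∀ᶠ n : ℕ in atTop, (randomKCNF k n (Δ * n)).toOuterMeasure
      {φ | ∃ pf : List (PropForm ℕ),
        textbookFrege.IsDepthProofOf d pf (PropForm.neg (PropForm.ofCNF φ)) ∧
          proofSize pf ≤ p.eval n} ≤
      1 - (randomKCNF k n (Δ * n)).toOuterMeasure
        {φ | ∀ pf : List (PropForm ℕ),
          textbookFrege.IsDepthProofOf d pf (PropForm.neg (PropForm.ofCNF φ)) →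
            (2 : ℝ) ^ ((n : ℝ) ^ ε) ≤ (proofSize pf : ℝ)} := by
    filter_upwards [hev] with n hn
    rw [← hcompl]
    refine measure_mono fun φ hφ hE => ?_
    obtain ⟨pf, hpf, hsz⟩ := hφ
    have h1 := hE pf hpf
    have h2 : (proofSize pf : ℝ) ≤ ((p.eval n : ℕ) : ℝ) := by exact_mod_cast hsz
    linarith
  have hlim : Tendsto (fun n : ℕ => 1 - (randomKCNF k n (Δ * n)).toOuterMeasure
      {φ | ∀ pf : List (PropForm ℕ),
        textbookFrege.IsDepthProofOf d pf (PropForm.neg (PropForm.ofCNF φ)) →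
          (2 : ℝ) ^ ((n : ℝ) ^ ε) ≤ (proofSize pf : ℝ)}) atTop (𝓝 0) := by
    have h := ENNReal.Tendsto.sub (tendsto_const_nhds (x := (1 : ENNReal))) hT
      (Or.inl ENNReal.one_ne_top)
    simpa using h
  exact tendsto_of_tendsto_of_tendsto_of_le_of_le' tendsto_const_nhds hlim
    (Eventually.of_forall fun n => bot_le) hle

end Summit.PneNP.PneNP.Theorems.LinGen
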